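import Summits.RiemannHypothesis.RiemannHypothesis.Theses.LiHeightLog
import Summits.RiemannHypothesis.RiemannHypothesis.Theorems.LiHeightLogLiBoxCosh
import Summits.RiemannHypothesis.RiemannHypothesis.Theorems.LiHeightLogLiCoshTailCountBound
import Summits.RiemannHypothesis.RiemannHypothesis.Theorems.LiHeightLogLiHeightBudgetLogBound
import Summits.RiemannHypothesis.RiemannHypothesis.Theorems.LiHeightLogAssembly
import HarnessLib

/-!
# RiemannHypothesis / LiHeightLog — CAPSTONE: the Li HEIGHT LAW in the LOGARITHMIC range is a theorem (RH-FREE)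

RH-FREE [rh-li-prover].  Route `Theses/LiHeightLog.lean` (round 6, rung L-P(P1-log) «Li HEIGHT LAW, LOGARITHMIC RANGE»,
cell `pub/rh-li`, dossier `theory/route/r6/README-R6.md`): the route's `closes` composition applied to the four landed
binders — `liBoxCosh_proof` (item `LiBoxCosh`, K1⁺ cosh box comparison, rh-li-log-p1), `sum_liCoshWeight_le_liCoshTail`
(the statement of the deciding crux `LiCoshTailCount`, N2 cosh tail count by zero counting alone, rh-li-log-p2,
`LiHeightLogLiCoshTailCountBound.lean`), `liHeightBudgetLog_bound` (the statement of `LiHeightBudgetLog`, K4″ closed budget,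
rh-li-log-p2, `LiHeightLogLiHeightBudgetLogBound.lean`), `liHeightLog_assembly_proof` (item `Assembly`, rh-li-log-p1) —
gives the LEAF

  `LiTheory.LiHeightLawLog`: if every zero of `ζ` with `0 < Im ρ ≤ T` (`T ≥ 1000`) lies on the critical line, then
  `λ_n ≥ 0` for every `1 ≤ n ≤ 2 T² log T`

— Brown's printed range (J. Number Theory 111 (2005) Thm 2, `T > T₀` inexplicit, proof incomplete: Droll 2012
Conj. 1.7.10/§5, Palojärvi 2020 §1) with the explicit threshold `T₀ = 1000`, by the cosh defect and zero COUNTING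
alone; together with the intermediate ALL-RANGE asymptotic law `LiTheory.LiAsymptoticLawAllRange`
(`|λ_n − (n/2) log n − C₁ n| ≤ 2 √n log n + liCoshDefect n T` for every `n ≥ 900`) and the free corollary of PART J
(`liPositivityPlattTrudgian26_of`): `λ_n ≥ 0` for `1 ≤ n ≤ 5·10²⁶` given the Platt–Trudgian verification
`T = 3 000 175 332 800`.  (PART J's other glue `liHeightLawQuadratic_of_log` recovers rung L-P(P1) `LiHeightLawQuadratic`,
already a theorem: `liHeightLawQuadratic_holds`.)

A FINITE verified height, finitely many coefficients: PROOF-OF-DATA, never distance-to-summit (the RH-equivalent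
statement is `∀ n`); nothing here bears on the truth of RH.
-/

noncomputable section

-- D-0017: `Summit.<S>.<S>.…` is the designed namespace of a single-problem summit.
set_option linter.dupNamespace false

namespace Summit.RiemannHypothesis.RiemannHypothesis.Theorems.LiTheory

open Literature.NumberTheory.LFunctions Literature.NumberTheory.LFunctions.SchoenfeldBound
open Literature.NumberTheory.DiophantineGeometry

open Summit.RiemannHypothesis.RiemannHypothesis.Theses.LiHeightLog in
/-- **The Li height law in the logarithmic range (LEAF of route `LiHeightLog`, rung L-P(P1-log); RH-FREE).**
`LiHeightLawLog` is a theorem: RH verified to `T ≥ 1000` ⇒ `λ_n ≥ 0` for `1 ≤ n ≤ 2T² log T` — the route's `closes`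
applied to the four landed binders (two by item name, two by their verbatim statements). -/
theorem liHeightLawLog_holds : LiHeightLawLog :=
  closes liBoxCosh_proof sum_liCoshWeight_le_liCoshTail liHeightBudgetLog_bound liHeightLog_assembly_proof

/-- **The all-range Li asymptotic law (RH-FREE)**: `LiAsymptoticLawAllRange` holds — RH verified to `T ≥ 1000` ⇒
`|λ_n − (n/2) log n − C₁ n| ≤ 2 √n log n + liCoshDefect n T` for every `n ≥ 900` (Assembly fed by K1⁺ and N2). -/
theorem liAsymptoticLawAllRange_holds : LiAsymptoticLawAllRange :=
  liHeightLog_assembly_proof liBoxCosh_proof sum_liCoshWeight_le_liCoshTail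

/-- **Corollary at the Platt–Trudgian height (RH-FREE)**: `LiPositivityPlattTrudgian26` holds — `λ_n ≥ 0` for every
`1 ≤ n ≤ 5·10²⁶`, given the Platt–Trudgian verification (`T = 3 000 175 332 800`, `2T² log T = 5.17·10²⁶`) as its
stated hypothesis (PART A reached `1.8·10²⁴`). -/
theorem liPositivityPlattTrudgian26_holds : LiPositivityPlattTrudgian26 :=
  liPositivityPlattTrudgian26_of liHeightLawLog_holds

end Summit.RiemannHypothesis.RiemannHypothesis.Theorems.LiTheory

end
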